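import Summits.AtomisticToContinuum.HydrodynamicLimit.Theses.AntiMazurCoboundaries
import Summits.AtomisticToContinuum.HydrodynamicLimit.Theorems.CellForecastPressureDecay.Negative.PerParticle
import Summits.AtomisticToContinuum.HydrodynamicLimit.Theorems.AntiMazurCoboundariesCellForecastPressureDecayObjects
import HarnessLib

/-!
# Objects of the crux line `enskog-compensator-martingale` (crux `CellForecastPressureDecay`,
# stmt-AtomisticToContinuum-13915; route AntiMazurCoboundaries, rank 6)

Objects module of the line (lead `prover-line-stmt-AtomisticToContinuum-13915-c2-0`, 2026-08-16): the
definitions of the registered skeleton `Cruxes/CellForecastPressureDecay/Lines/enskog-compensator-martingale.lean`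
(planner-cruxplan seat) §0–§1, moved verbatim into an importable `Theorems` module so that the stub helper
files of the line (one per registered stub, `--supports stmt-AtomisticToContinuum-13915`) and the eventual
closing file share ONE copy of them, plus the static position-space objects of the lead's reshape of stub S2
(`exactKinematicRates` = statics + kinematics):

* §0 frame: `Cell`, `CFlow`, `Flows`, `cellLaw` (the canonical cell Gibbs law `P_{n,L}` of the crux, verbatim),
  `fvel` (the range-`R` forecast velocity), `Orthogonal` (the crux's `g ⊥ span{1,v,|v|²}`), `pairKernel`
  (the Enskog–Boltzmann pair kernel `K_w`), `windowInt`, `compensated` (the compensated collision process `M_t`);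
* §1 position statics: `pos`, `vel`, `posAdmissible` (hard-core admissible positions in the cube), `posZ`
  (its volume = the positional partition function), `posLaw` (uniform law on it);
* §2 the named obligations (Props) of the line: `CellLawFactorises` (S2a), `ContactLayerBounds` (S2b),
  `ContactStatistics` (S2c), `KinematicRates` (S2, the planner's interface, consumed by S3/S4), `WindowL2Rate`
  (S3), `TiltStability` (S4 = C⁺);
* §3 basic API (unfolding lemmas, `M_0 ≡ 0`, the lone particle, the line's pointwise identity and the
  coboundary bound).

Sources: line card `Lines/enskog-compensator-martingale.md`, idea card `Ideas/enskog-compensator-martingale.md`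
(Enskog–Poisson compensator; Spohn 1991 §8.4 first-collision compensator; CIP 1994 §2–3 collision cylinders;
Kipnis–Varadhan 1986 / Komorowski–Landim–Olla 2012 martingale approximation via the Poisson equation).
-/

noncomputable section

open MeasureTheory ProbabilityTheory Set Filter
open scoped ENNReal BigOperators InnerProductSpace
open Literature.Analysis.FluidPDE Literature.MathematicalPhysics.KineticTheory
open Literature.Analysis.UnboundedOperators (hardSphereLinearizedOp)
open Summit.AtomisticToContinuum.HydrodynamicLimit.Theorems.CellForecastPressureDecay
  (cellRef vel_localClusterState_of_card_le_one)

namespace Summit.AtomisticToContinuum.HydrodynamicLimit.Theorems.EnskogCompensator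

/-! ## § 0 Frame (the crux's objects, named; verbatim from the skeleton) -/

/-- Phase space of `n` spheres in `ℝ³` (positions in `V3`, free boundary). -/
abbrev Cell (n : ℕ) : Type := Config n (Fin 3) V3

/-- Euclidean hard-sphere flows of `k` spheres of diameter `σ` (the crux's cluster dynamics `Ψ k`). -/
abbrev CFlow (σ : ℝ) (k : ℕ) : Type := HardSphereFlow (Euclidean.geometry (Fin 3)) σ k

/-- Families of Euclidean hard-sphere flows, one for every particle number (the crux's `Ψ`). -/
abbrev Flows (σ : ℝ) : Type := (k : ℕ) → CFlow σ k

/-- The canonical cell Gibbs law `P_{n,L}` of the crux: `n` spheres of diameter `σ`, hard-core uniform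
positions in `[0,L]³`, i.i.d. standard Maxwellian velocities (`cellRef L = 1_{[0,L]³} ⊗ M`, landed). -/
def cellLaw (σ L : ℝ) (n : ℕ) (Ψ : Flows σ) : Measure (Cell n) :=
  particleLaw (Ψ n) (canonicalDensity (Euclidean.geometry (Fin 3)) σ n (cellRef L))

/-- The **forecast velocity** `ṽᵢ(t)` of particle `i`: its velocity at time `t` when only its range-`R`
cluster is evolved under its isolated dynamics (`localClusterState`, exactly as in the crux). -/
def fvel {σ : ℝ} {n : ℕ} (Ψ : Flows σ) (R t : ℝ) (z : Cell n) (i : Fin n) : V3 :=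
  (localClusterState Ψ R t z i).2

/-- The orthogonality clause of the crux: `g ⊥ span{1, v, |v|²}` in `L²(stdGaussian ℝ³)`. -/
def Orthogonal (g : V3 → ℝ) : Prop :=
  ∀ (c₀ c₂ : ℝ) (b : V3), ∫ v, g v * (c₀ + inner ℝ b v + c₂ * ‖v‖ ^ 2) ∂(stdGaussian V3) = 0

/-- The **Enskog–Boltzmann pair kernel** `K_w(v,u) = ∫_{S²} ((v−u)·ω)₊ (w(v') + w(u') − w(v) − w(u)) dω`:
the expected change of `w(v) + w(u)` in a collision of velocities `(v,u)` weighted by the kinematic rate.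
Its Maxwellian average in `u` is `(L w)(v)` by definition of `hardSphereLinearizedOp` (`pairKernel_maxwellian`). -/
def pairKernel (w : V3 → ℝ) (v u : V3) : ℝ :=
  ∫ ω, hardSphereKernel (v, u) ω *
    (w (collide ω (v, u)).1 + w (collide ω (v, u)).2 - w v - w u) ∂sphereMeasure

/-- The window integral `Aᵢ = ∫₀ᵀ g(ṽᵢ(t)) dt` of particle `i` (the crux's integrand is `2c ∑ᵢ T⁻¹ Aᵢ`). -/
def windowInt {σ : ℝ} {n : ℕ} (g : V3 → ℝ) (Ψ : Flows σ) (R T : ℝ) (z : Cell n) (i : Fin n) : ℝ :=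
  ∫ t in (0 : ℝ)..T, g (fvel Ψ R t z i)

/-- The **compensated collision process**
`M_t = ∑ᵢ [ν⁻¹ (w(ṽᵢ(t)) − w(ṽᵢ(0))) − ∫₀ᵗ g(ṽᵢ(s)) ds]`: the jumps of the Boltzmann-level antiderivative
`ν⁻¹ ∑ᵢ w(ṽᵢ)` (`w(ṽᵢ)` is constant on free flights) minus their Boltzmann–Enskog compensator. -/
def compensated {σ : ℝ} {n : ℕ} (w : V3 → ℝ) (ν : ℝ) (g : V3 → ℝ) (Ψ : Flows σ) (R t : ℝ) (z : Cell n) : ℝ :=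
  ∑ i, (ν⁻¹ * (w (fvel Ψ R t z i) - w (fvel Ψ R 0 z i)) - windowInt g Ψ R t z i)

/-! ## § 1 Position statics of the cell law (the lead's reshape of S2) -/

/-- The positions of a configuration. -/
def pos {n : ℕ} (z : Cell n) : Fin n → V3 := fun i => (z i).1

/-- The velocities of a configuration. -/
def vel {n : ℕ} (z : Cell n) : Fin n → V3 := fun i => (z i).2

/-- The **admissible position configurations** of the cell: centres pairwise at distance `≥ σ` (hard core,
closed) and every centre in the cube `[0,L]³`. -/
def posAdmissible (σ L : ℝ) (n : ℕ) : Set (Fin n → V3) :=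
  {x | (∀ i j, i ≠ j → σ ≤ ‖x i - x j‖) ∧ ∀ i k, x i k ∈ Set.Icc (0 : ℝ) L}

/-- The **positional partition function**: the Lebesgue volume of the admissible set (it equals the crux's
`canonicalPartition … (cellRef L)`, the Maxwellians integrating to one — part of `CellLawFactorises`). -/
def posZ (σ L : ℝ) (n : ℕ) : ℝ≥0∞ := volume (posAdmissible σ L n)

/-- The **position law** of the cell: the uniform probability measure on the admissible set (the zero
measure when the admissible set is null). -/
def posLaw (σ L : ℝ) (n : ℕ) : Measure (Fin n → V3) :=
  (posZ σ L n)⁻¹ • volume.restrict (posAdmissible σ L n)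

/-! ## § 2 The named obligations of the line (Props asserted by the registered stubs) -/

/-- **S2a · the cell law factorises**: under `P_{n,L}` the velocities are i.i.d. standard Maxwellian and
independent of the positions, whose law is the uniform law on the admissible set:
`(pos, vel)_* P_{n,L} = posLaw ⊗ γ^{⊗n}` (all `σ, L, n`; both sides are `0` when the admissible set is null). -/
def CellLawFactorises (σ : ℝ) : Prop :=
  ∀ (L : ℝ) (n : ℕ) (Ψ : Flows σ),
    (cellLaw σ L n Ψ).map (fun z => (pos z, vel z)) =
      (posLaw σ L n).prod (Measure.pi fun _ : Fin n => stdGaussian V3)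

/-- **S2b · contact-layer bounds** (insertion bound `vol(adm_{n}) ≥ (L³/2)·vol(adm_{n−1})` for `σ ≤ 3/16`,
`n ≤ 2L³`, iterated): one constant `C` such that for `L ≥ 1`, `n ≤ 2L³`: (a) a given pair of centres is
within `σ + r` with probability `≤ C(r + r³)/L³`; (b) a given chain `i – j – k` of two such closeness relations
(radii `r, r'`) has probability `≤ C²(r + r³)(r' + r'³)/L⁶`; (c) a given centre is within `r` of the boundary
of the cube with probability `≤ C r / L`. -/
def ContactLayerBounds (σ : ℝ) : Prop :=
  ∃ C : ℝ, 0 ≤ C ∧ ∀ L : ℝ, 1 ≤ L → ∀ n : ℕ, (n : ℝ) ≤ 2 * L ^ 3 →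
    (∀ r : ℝ, 0 ≤ r → ∀ i j : Fin n, i ≠ j →
      posLaw σ L n {x | ‖x i - x j‖ ≤ σ + r} ≤ ENNReal.ofReal (C * (r + r ^ 3) / L ^ 3)) ∧
    (∀ r r' : ℝ, 0 ≤ r → 0 ≤ r' → ∀ i j k : Fin n, i ≠ j → j ≠ k → i ≠ k →
      posLaw σ L n {x | ‖x i - x j‖ ≤ σ + r ∧ ‖x j - x k‖ ≤ σ + r'} ≤
        ENNReal.ofReal (C ^ 2 * (r + r ^ 3) * (r' + r' ^ 3) / L ^ 6)) ∧
    (∀ r : ℝ, 0 ≤ r → ∀ i : Fin n,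
      posLaw σ L n {x | ∃ k, x i k < r ∨ L - r < x i k} ≤ ENNReal.ofReal (C * r / L))

/-- **S2c · near-contact pair statistics are homogeneous and isotropic in volume average**: for `L ≥ L₀`,
`n ≤ 2L³` there is ONE constant `c₂ ≥ 0` (`= n(n−1) ×` the spherically averaged contact value of the
volume-averaged relative-position density of a pair; the translation-averaged contact value of the canonical
pair density) such that for every bounded measurable test function `φ` of the relative position supported in
the shell `σ ≤ |q| ≤ σ + r`, `r ≤ 1`:
`|∑_{i≠j} E φ(xᵢ − xⱼ) − c₂ ∫ φ(q) dq| ≤ C (r L² + r² L³) sup|φ|`.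
The `r²L³` term is the radial variation of the pair density across the shell; the `rL²` term is the ONLY place
where direction- and position-dependence may enter: cube-boundary layer `O(σL²)` pairs, and bulk corrections
that are summable in the distance to the boundary — i.e. exact isotropy of the low-density infinite-volume
hard-sphere state (uniqueness / convergent Mayer–Kirkwood–Salsburg expansion at packing fraction `≤ (π/3)σ³`;
Ruelle 1969 Ch. 4). Static; cluster-expansion grade. -/
def ContactStatistics (σ : ℝ) : Prop :=
  ∃ C : ℝ, 0 ≤ C ∧ ∃ L₀ : ℝ, 1 ≤ L₀ ∧ ∀ L : ℝ, L₀ ≤ L → ∀ n : ℕ, (n : ℝ) ≤ 2 * L ^ 3 →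
    ∃ c₂ : ℝ, 0 ≤ c₂ ∧ ∀ r : ℝ, 0 ≤ r → r ≤ 1 →
      ∀ φ : V3 → ℝ, Measurable φ → (∀ q, |φ q| ≤ 1) → (∀ q, φ q ≠ 0 → σ ≤ ‖q‖ ∧ ‖q‖ ≤ σ + r) →
        |(∑ i : Fin n, ∑ j : Fin n, if i = j then 0 else ∫ x, φ (x i - x j) ∂(posLaw σ L n)) -
            c₂ * ∫ q, φ q| ≤ C * (r * L ^ 2 + r ^ 2 * L ^ 3)

/-- **S2 · equal-time Enskog kinematics of the cell law at diameter `σ`** (card: `ExactKinematicRates`; the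
planner's interface, consumed by S3 and S4). For every bounded continuous `w` there are `C` and `L₀` such that
for every cell `L ≥ L₀`, `n ≤ 2L³`, every cluster dynamics `Ψ`, ONE static constant `c₂ ≥ 0` makes, for every
continuous velocity functional `|F| ≤ 1` and every slab length `Δ ∈ (0,1]`,
`|E_P[F(v(0)) · (∑ᵢ [w(vᵢ(Δ)) − w(vᵢ(0))] − Δ c₂ ∑_{i≠j} K_w(vᵢ,vⱼ))]| ≤ C (L³Δ² + L²Δ)`,
velocities evolved by the WHOLE-CELL isolated hard-sphere dynamics `(Ψ n).flow`. -/
def KinematicRates (σ : ℝ) : Prop :=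
  ∀ (w : V3 → ℝ) (b : ℝ), Continuous w → (∀ v, |w v| ≤ b) →
    ∃ C : ℝ, ∃ L₀ : ℝ, 0 < L₀ ∧ ∀ L : ℝ, L₀ ≤ L → ∀ n : ℕ, (n : ℝ) ≤ 2 * L ^ 3 →
      ∀ Ψ : Flows σ, ∃ c₂ : ℝ, 0 ≤ c₂ ∧
        ∀ F : (Fin n → V3) → ℝ, Continuous F → (∀ x, |F x| ≤ 1) →
          ∀ Δ : ℝ, 0 < Δ → Δ ≤ 1 →
            |∫ z, F (fun i => (z i).2) *
                ((∑ i, (w ((Ψ n).flow Δ z i).2 - w (z i).2)) -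
                  Δ * c₂ * ∑ i, ∑ j, if i = j then 0 else pairKernel w (z i).2 (z j).2)
                ∂(cellLaw σ L n Ψ)| ≤
              C * (L ^ 3 * Δ ^ 2 + L ^ 2 * Δ)

/-- **S3 · the centred L² crux with rate `1/T` at diameter `σ`** (card: `CompensatorL2Rate`; the `k = 2` sum
rule in its ν-free form). For bounded continuous `g ⊥ span{1,v,|v|²}`:
`∃ C ∃ T₀ ∀ T ≥ T₀ ∃ R₀ ∀ R ≥ R₀ ∃ L₀ ∀ L ≥ L₀ ∀ n ≤ 2L³ ∀ Ψ ∃ m: E_P (∑ᵢ T⁻¹∫₀ᵀ g(ṽᵢ) − m)² ≤ C L³ / T`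
(free centre `m`; open at fixed `σ` — the cell twin of stmt-10952 WITH a rate). -/
def WindowL2Rate (σ : ℝ) : Prop :=
  ∀ (g : V3 → ℝ) (b : ℝ), Continuous g → (∀ v, |g v| ≤ b) → Orthogonal g →
    ∃ C : ℝ, ∃ T₀ : ℝ, 1 ≤ T₀ ∧ ∀ T : ℝ, T₀ ≤ T → ∃ R₀ : ℝ, 0 < R₀ ∧ ∀ R : ℝ, R₀ ≤ R →
      ∃ L₀ : ℝ, 0 < L₀ ∧ ∀ L : ℝ, L₀ ≤ L → ∀ n : ℕ, (n : ℝ) ≤ 2 * L ^ 3 →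
        ∀ Ψ : Flows σ, ∃ m : ℝ,
          ∫⁻ z, ENNReal.ofReal ((∑ i, T⁻¹ * windowInt g Ψ R T z i - m) ^ 2) ∂(cellLaw σ L n Ψ) ≤
            ENNReal.ofReal (C * L ^ 3 / T)

/-- **S4 · one-slab tilt-stability of the compensated collision process at diameter `σ`** (card:
`TiltStability`, the transfer target C⁺). There is an amplitude `κ > 0` such that for every continuous
`|g| ≤ κ`, `g ⊥ span{1,v,|v|²}`, and every bounded continuous solution `w` of `L w = g`:
`∃ C > 0 ∃ Δ ∈ (0,1] ∃ T₀ ≥ 1 ∀ T ≥ T₀ ∀ η > 0 ∃ B ≥ 0 ∃ R₀ ∀ R ≥ R₀ ∃ L₀ ∀ L ≥ L₀ ∀ n ≤ 2L³ ∀ Ψ ∃ ν > 0`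
with `n ≤ C ν L³` such that for `|θ| ≤ 2/T`, `0 ≤ t`, `0 < Δ' ≤ Δ`, `t + Δ' ≤ T`:
`E_P exp(θ M_{t+Δ'}) ≤ exp((C θ² L³ + η L³ + B L²) Δ') · E_P exp(θ M_t)`, `M = compensated w ν g Ψ R`.
Stronger than the crux (it outputs the rate `1/T`); the open content of the line. -/
def TiltStability (σ : ℝ) : Prop :=
  ∃ κ : ℝ, 0 < κ ∧ ∀ g : V3 → ℝ, Continuous g → (∀ v, |g v| ≤ κ) → Orthogonal g →
    ∀ (w : V3 → ℝ) (b : ℝ), Continuous w → (∀ v, |w v| ≤ b) → hardSphereLinearizedOp w = g →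
      ∃ C : ℝ, 0 < C ∧ ∃ Δ : ℝ, 0 < Δ ∧ Δ ≤ 1 ∧ ∃ T₀ : ℝ, 1 ≤ T₀ ∧ ∀ T : ℝ, T₀ ≤ T → ∀ η : ℝ, 0 < η →
        ∃ B : ℝ, 0 ≤ B ∧ ∃ R₀ : ℝ, 0 < R₀ ∧ ∀ R : ℝ, R₀ ≤ R →
          ∃ L₀ : ℝ, 0 < L₀ ∧ ∀ L : ℝ, L₀ ≤ L → ∀ n : ℕ, (n : ℝ) ≤ 2 * L ^ 3 →
            ∀ Ψ : Flows σ, ∃ ν : ℝ, 0 < ν ∧ (n : ℝ) ≤ C * ν * L ^ 3 ∧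
              ∀ θ : ℝ, |θ| ≤ 2 / T → ∀ t Δ' : ℝ, 0 ≤ t → 0 < Δ' → Δ' ≤ Δ → t + Δ' ≤ T →
                ∫⁻ z, ENNReal.ofReal (Real.exp (θ * compensated w ν g Ψ R (t + Δ') z))
                    ∂(cellLaw σ L n Ψ) ≤
                  ENNReal.ofReal (Real.exp ((C * θ ^ 2 * L ^ 3 + η * L ^ 3 + B * L ^ 2) * Δ')) *
                    ∫⁻ z, ENNReal.ofReal (Real.exp (θ * compensated w ν g Ψ R t z))
                      ∂(cellLaw σ L n Ψ)

/-! ## § 3 Basic API of the objects -/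

/-- The cell law is literally the measure of the crux. [folklore] -/
theorem cellLaw_eq (σ L : ℝ) (n : ℕ) (Ψ : Flows σ) :
    cellLaw σ L n Ψ = particleLaw (Ψ n) (canonicalDensity (Euclidean.geometry (Fin 3)) σ n
      (fun p => Set.indicator {x : V3 | ∀ k, x k ∈ Set.Icc (0 : ℝ) L} (fun _ => (1 : ℝ)) p.1 *
        globalMaxwellian p.2)) := rfl

/-- The cell law of this line is the cell law of the tilt line's objects module (same measure, other argument
order), so that lemmas proved for either apply to both. [folklore] -/
theorem cellLaw_eq_tilt (σ L : ℝ) (n : ℕ) (Ψ : Flows σ) :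
    cellLaw σ L n Ψ = TiltAnalyticity.cellLaw σ n L (Ψ n) := rfl

/-- Unfolding lemma for `pos`. [folklore] -/
@[simp] theorem pos_apply {n : ℕ} (z : Cell n) (i : Fin n) : pos z i = (z i).1 := rfl

/-- Unfolding lemma for `vel`. [folklore] -/
@[simp] theorem vel_apply {n : ℕ} (z : Cell n) (i : Fin n) : vel z i = (z i).2 := rfl

/-- Membership in the admissible set. [folklore] -/
theorem mem_posAdmissible {σ L : ℝ} {n : ℕ} {x : Fin n → V3} :
    x ∈ posAdmissible σ L n ↔ (∀ i j, i ≠ j → σ ≤ ‖x i - x j‖) ∧ ∀ i k, x i k ∈ Set.Icc (0 : ℝ) L :=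
  Iff.rfl

/-- Unfolding lemma for `posLaw`. [folklore] -/
theorem posLaw_eq (σ L : ℝ) (n : ℕ) :
    posLaw σ L n = (posZ σ L n)⁻¹ • volume.restrict (posAdmissible σ L n) := rfl

/-- `∫ K_w(v,u) M(u) du = (L w)(v)` — definitionally. [folklore] -/
theorem pairKernel_maxwellian (w : V3 → ℝ) (v : V3) :
    ∫ u, pairKernel w v u ∂(stdGaussian V3) = hardSphereLinearizedOp w v := rfl

/-- `M_0 ≡ 0`. [folklore] -/
theorem compensated_zero {σ : ℝ} {n : ℕ} (w : V3 → ℝ) (ν : ℝ) (g : V3 → ℝ) (Ψ : Flows σ) (R : ℝ)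
    (z : Cell n) : compensated w ν g Ψ R 0 z = 0 := by
  simp [compensated, windowInt]

/-- Consistency with the landed lone-particle lemma (`Negative/LoneParticle`, p73994): for `n = 1` every
forecast is free flight, so `M_t = −t·g(v)`. [folklore] -/
theorem compensated_lone {σ : ℝ} (w : V3 → ℝ) (ν : ℝ) (g : V3 → ℝ) (Ψ : Flows σ) (R t : ℝ) (z : Cell 1) :
    compensated w ν g Ψ R t z = -(t * g (z 0).2) := by
  have hcard : ∀ i : Fin 1, (rangeCluster (Euclidean.geometry (Fin 3)) R z i).card ≤ 1 :=
    fun i => (Finset.card_le_univ _).trans (by simp)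
  simp only [compensated, windowInt, fvel, vel_localClusterState_of_card_le_one Ψ (hcard _),
    intervalIntegral.integral_const, sub_zero, smul_eq_mul, Fin.sum_univ_one, sub_self, mul_zero, zero_sub,
    Fin.isValue]

/-- THE IDENTITY OF THE LINE (pointwise, exact): with `θ = −2c/T`,
`2c ∑ᵢ T⁻¹ Aᵢ = (2c/T) · ν⁻¹ ∑ᵢ [w(ṽᵢ(T)) − w(ṽᵢ(0))] + θ · M_T`. [folklore] -/
theorem crux_exponent_eq {σ : ℝ} {n : ℕ} (w : V3 → ℝ) (ν : ℝ) (g : V3 → ℝ) (Ψ : Flows σ) (R : ℝ)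
    {T : ℝ} (hT : T ≠ 0) (c : ℝ) (z : Cell n) :
    2 * c * ∑ i, T⁻¹ * windowInt g Ψ R T z i =
      (2 * c / T) * (ν⁻¹ * ∑ i, (w (fvel Ψ R T z i) - w (fvel Ψ R 0 z i))) +
        (-(2 * c / T)) * compensated w ν g Ψ R T z := by
  simp only [compensated, Finset.sum_sub_distrib, ← Finset.mul_sum]
  field_simp
  ring

/-- The coboundary is bounded pointwise: `|ν⁻¹ ∑ᵢ [w(ṽᵢ(T)) − w(ṽᵢ(0))]| ≤ ν⁻¹ · 2bn`. [folklore] -/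
theorem abs_coboundary_le {σ : ℝ} {n : ℕ} (w : V3 → ℝ) {b : ℝ} (hwb : ∀ v, |w v| ≤ b) {ν : ℝ} (hν : 0 < ν)
    (Ψ : Flows σ) (R T : ℝ) (z : Cell n) :
    |ν⁻¹ * ∑ i, (w (fvel Ψ R T z i) - w (fvel Ψ R 0 z i))| ≤ ν⁻¹ * (2 * b * n) := by
  rw [abs_mul, abs_of_pos (inv_pos.2 hν)]
  refine mul_le_mul_of_nonneg_left ?_ (inv_pos.2 hν).le
  calc |∑ i, (w (fvel Ψ R T z i) - w (fvel Ψ R 0 z i))|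
      ≤ ∑ i, |w (fvel Ψ R T z i) - w (fvel Ψ R 0 z i)| := Finset.abs_sum_le_sum_abs _ _
    _ ≤ ∑ _i : Fin n, 2 * b := Finset.sum_le_sum fun i _ => by
        have h1 := hwb (fvel Ψ R T z i)
        have h2 := hwb (fvel Ψ R 0 z i)
        have h3 := abs_sub (w (fvel Ψ R T z i)) (w (fvel Ψ R 0 z i))
        linarith
    _ = 2 * b * n := by simp [Finset.sum_const, Finset.card_univ, mul_comm]


/-! ## § 4 The registered bookkeeping stub of the objects module -/

/-- **Registered bookkeeping stub `stub_enskogObjects`** of the line `enskog-compensator-martingale` (crux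
stmt-AtomisticToContinuum-13915): (i) the cell law is literally the crux's measure, (ii) the compensated process
starts at `0`, (iii) the position law is the normalised Lebesgue measure of the admissible set. [folklore] -/
theorem stub_enskogObjects :
    (∀ (σ L : ℝ) (n : ℕ) (Ψ : Flows σ), cellLaw σ L n Ψ = particleLaw (Ψ n)
      (canonicalDensity (Euclidean.geometry (Fin 3)) σ n
        (fun p => Set.indicator {x : V3 | ∀ k, x k ∈ Set.Icc (0 : ℝ) L} (fun _ => (1 : ℝ)) p.1 *
          globalMaxwellian p.2))) ∧
    (∀ (σ : ℝ) (n : ℕ) (w : V3 → ℝ) (ν : ℝ) (g : V3 → ℝ) (Ψ : Flows σ) (R : ℝ) (z : Cell n),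
      compensated w ν g Ψ R 0 z = 0) ∧
    (∀ (σ L : ℝ) (n : ℕ), posLaw σ L n = (posZ σ L n)⁻¹ • volume.restrict (posAdmissible σ L n)) :=
  ⟨fun σ L n Ψ => cellLaw_eq σ L n Ψ, fun _ _ w ν g Ψ R z => compensated_zero w ν g Ψ R z,
    fun σ L n => posLaw_eq σ L n⟩

end Summit.AtomisticToContinuum.HydrodynamicLimit.Theorems.EnskogCompensator

end
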